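import Literature.Probability.LatticeModels.LatticeHarnackOneScale
import Summits.CriticalPhenomena.CardyFormulaZ2.Theorems.CardyBoundaryCoulombGasBoundaryDefectGaussianRStubClusterLocalityV2Part3

/-!
# Stub `stub_clusterLocalityV2` of line `rainbow-monomials-in-excursion-kernels` — Part 4:
# hole-freeness of punctured half-rectangles and the harmonic measure of the top side of a
# wide rectangle (crux `BoundaryDefectGaussianR`, stmt-CriticalPhenomena-14132)

Two geometric inputs of step (C) (the lower bound `G_Q(x, y) ≥ c/(|x - y| + 1)²` for two points
of the bottom row) of the Green-locality half G1 of `stub_clusterLocalityV2`: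

* `holeFree_halfRect_erase` — a half-rectangle `{|v₀ - y₀| ≤ n, y₁ ≤ v₁ ≤ y₁ + T}` with one
  bottom-row point removed is HOLE-FREE in the sense of the tree (`HoleFree`: every outside face
  escapes to infinity by side-adjacent outside faces), the hypothesis of the tree's one-scale
  Harnack inequality `harnack_one_scale` (Lawler–Schramm–Werner 2004, Lemma 5.2), which Part 5
  applies to `G_Q(·, y)` on `Q ∖ {y}`;
* `sum_poissonKernel_top_ge` — from the centre `x` of the bottom row of the WIDE rectangle
  `R = {|v₀ - x₀| ≤ n, x₁ ≤ v₁ ≤ x₁ + T}` with `n + 1 = 4(T + 1)`, the harmonic measure of the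
  top row of `∂R` is at least `(15/19)/(T+2)`: Green's representation of the harmonic quadratic
  `w = (Y+1)/(T+2) - (16/15)(X² - (Y+1)²)/(n+1)²`, which is `≤ 0` on the bottom row and the
  sides, `≤ 19/15` on the top row, and `≥ 1/(T+2)` at `x` (the gambler's-ruin order `1/T` of
  reaching height `T` before the absorbing row, localised to a rectangle four times as wide).

All statements are folklore (Lawler–Limic 2010, §6.2, §8.1).
-/

noncomputable section

namespace Summit.CriticalPhenomena.CardyFormulaZ2.Cruxes.BoundaryDefectGaussianR.RainbowMonomialsInExcursionKernels

open Finset Literature.Probability.LatticeModels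

/-! ### Chains of face steps along rays outside a set -/

/-- The site `k` steps right of `s`. [folklore] -/
theorem nsmul_cornerUnit_zero_apply (s : Site 2) (k : ℕ) :
    (s + k • cornerUnit 0) 0 = s 0 + k ∧ (s + k • cornerUnit 0) 1 = s 1 := by
  simp [Pi.add_apply]

/-- A vertical ray outside `U` is a chain of face steps avoiding `U`. [folklore] -/
theorem reflTransGen_faceStep_up {U : Set (Site 2)} {g : Site 2}
    (hg : ∀ k : ℕ, g + k • cornerUnit 1 ∉ U) (K : ℕ) :
    Relation.ReflTransGen (FaceStep U) g (g + K • cornerUnit 1) := by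
  induction K with
  | zero => rw [zero_nsmul, add_zero]
  | succ K ih =>
    refine ih.tail ⟨?_, hg K, hg (K + 1)⟩
    rw [succ_nsmul, ← add_assoc]
    exact cSrc_mem_edgeSet (g + K • cornerUnit 1, 1)

/-- A horizontal segment outside `U` is a chain of face steps avoiding `U`. [folklore] -/
theorem reflTransGen_faceStep_right {U : Set (Site 2)} {g : Site 2} {K : ℕ}
    (hg : ∀ k : ℕ, k ≤ K → g + k • cornerUnit 0 ∉ U) :
    Relation.ReflTransGen (FaceStep U) g (g + K • cornerUnit 0) := by
  induction K with
  | zero => rw [zero_nsmul, add_zero]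
  | succ K ih =>
    refine (ih fun k hk => hg k (by omega)).tail ⟨?_, hg K (by omega), hg (K + 1) le_rfl⟩
    rw [succ_nsmul, ← add_assoc]
    exact cSrc_mem_edgeSet (g + K • cornerUnit 0, 0)

/-! ### Punctured half-rectangles are hole-free -/

/-- **A half-rectangle with one bottom-row point removed is hole-free**: from outside the
rectangle one escapes straight up (beside or above it) or first sideways below it; from the
removed bottom-row point one first steps down. [folklore] -/
theorem holeFree_halfRect_erase {Q : Finset (Site 2)} {y : Site 2} {n T : ℕ}
    (hQ : ∀ v : Site 2, v ∈ Q ↔ (y 0 - n ≤ v 0 ∧ v 0 ≤ y 0 + n) ∧ (y 1 ≤ v 1 ∧ v 1 ≤ y 1 + T))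
    {p : Site 2} (hp : p 1 = y 1) : HoleFree (↑(Q.erase p) : Set (Site 2)) := by
  intro g hg M
  set U : Set (Site 2) := ↑(Q.erase p) with hUdef
  have hU : ∀ v : Site 2, v ∈ U ↔
      v ≠ p ∧ ((y 0 - n ≤ v 0 ∧ v 0 ≤ y 0 + n) ∧ (y 1 ≤ v 1 ∧ v 1 ≤ y 1 + T)) := fun v => by
    rw [hUdef, Finset.mem_coe, Finset.mem_erase, hQ]
  -- beside or above the rectangle: go straight up
  have up : ∀ g' : Site 2, (g' 0 < y 0 - n ∨ y 0 + n < g' 0 ∨ y 1 + T < g' 1) →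
      ∃ g'', M ≤ g'' 1 ∧ Relation.ReflTransGen (FaceStep U) g' g'' := by
    intro g' hg'
    obtain ⟨K, hK⟩ : ∃ K : ℕ, M ≤ g' 1 + K := ⟨(M - g' 1).toNat, by omega⟩
    refine ⟨g' + K • cornerUnit 1, by rw [(nsmul_cornerUnit_one_apply g' K).2]; exact hK,
      reflTransGen_faceStep_up (fun k => ?_) K⟩
    rw [hU]
    have := nsmul_cornerUnit_one_apply g' k
    intro h; omega
  -- strictly below the rectangle: go right beyond its columns, then up
  have below : ∀ g' : Site 2, g' 1 < y 1 →
      ∃ g'', M ≤ g'' 1 ∧ Relation.ReflTransGen (FaceStep U) g' g'' := by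
    intro g' hg'
    obtain ⟨K, hK⟩ : ∃ K : ℕ, y 0 + n < g' 0 + K := ⟨(y 0 + n + 1 - g' 0).toNat, by omega⟩
    have h1 : Relation.ReflTransGen (FaceStep U) g' (g' + K • cornerUnit 0) :=
      reflTransGen_faceStep_right fun k _ => by
        rw [hU]
        have := nsmul_cornerUnit_zero_apply g' k
        intro h; omega
    obtain ⟨g'', hM, h2⟩ := up (g' + K • cornerUnit 0)
      (Or.inr (Or.inl (by rw [(nsmul_cornerUnit_zero_apply g' K).1]; exact hK)))
    exact ⟨g'', hM, h1.trans h2⟩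
  by_cases hgp : g = p
  · -- the removed point: step down first
    have hg1 : g 1 = y 1 := by rw [hgp]; exact hp
    have hdown : (g + cornerUnit 3) 1 = g 1 - 1 := by simp [Pi.add_apply, sub_eq_add_neg]
    have hstep : FaceStep U g (g + cornerUnit 3) := by
      refine ⟨cSrc_mem_edgeSet (g, 3), hg, ?_⟩
      rw [hU]
      intro h
      omega
    obtain ⟨g'', hM, h2⟩ := below (g + cornerUnit 3) (by omega)
    exact ⟨g'', hM, Relation.ReflTransGen.head hstep h2⟩
  · have hspec : ¬ ((y 0 - n ≤ g 0 ∧ g 0 ≤ y 0 + n) ∧ (y 1 ≤ g 1 ∧ g 1 ≤ y 1 + T)) :=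
      fun h => hg ((hU g).2 ⟨hgp, h⟩)
    rcases (show g 0 < y 0 - n ∨ y 0 + n < g 0 ∨ y 1 + T < g 1 ∨ g 1 < y 1 by omega) with
      h | h | h | h
    · exact up g (Or.inl h)
    · exact up g (Or.inr (Or.inl h))
    · exact up g (Or.inr (Or.inr h))
    · exact below g h

/-! ### The harmonic measure of the top side of a wide rectangle -/

section TopBarrier

variable {x : Site 2} {n T : ℕ} {w : Site 2 → ℝ}
  (hw : ∀ v : Site 2, w v = (((v 1 - x 1 : ℤ) : ℝ) + 1) / ((T : ℝ) + 2) -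
    16 / 15 * (((v 0 - x 0 : ℤ) : ℝ) ^ 2 - (((v 1 - x 1 : ℤ) : ℝ) + 1) ^ 2) / ((n : ℝ) + 1) ^ 2)
include hw

/-- The top barrier `w = (Y+1)/(T+2) - (16/15)(X² - (Y+1)²)/(n+1)²` is discrete harmonic on all
of `ℤ²` (`Δ X² = Δ (Y+1)² = 2`). [folklore] -/
theorem latticeLaplacianZd_topBarrier (v : Site 2) : latticeLaplacianZd w v = 0 := by
  rw [latticeLaplacianZd_two]
  obtain ⟨⟨a0, a1⟩, ⟨b0, b1⟩, ⟨c0, c1⟩, ⟨d0, d1⟩⟩ := neighbour_coords v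
  simp only [hw, a0, a1, b0, b1, c0, c1, d0, d1]
  have hn1 : ((n : ℝ) + 1) ≠ 0 := by positivity
  have hT2 : ((T : ℝ) + 2) ≠ 0 := by positivity
  push_cast
  field_simp
  ring

/-- On the bottom row `Y = -1`, `w = -(16/15) X²/(n+1)² ≤ 0`. [folklore] -/
theorem topBarrier_bottom_nonpos {v : Site 2} (hv : v 1 = x 1 - 1) : w v ≤ 0 := by
  rw [hw]
  have hY : ((v 1 - x 1 : ℤ) : ℝ) + 1 = 0 := by
    have : (v 1 - x 1 : ℤ) = -1 := by omega
    rw [this]; push_cast; ring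
  rw [hY]
  have : 0 ≤ 16 / 15 * (((v 0 - x 0 : ℤ) : ℝ) ^ 2 - (0 : ℝ) ^ 2) / ((n : ℝ) + 1) ^ 2 := by
    apply div_nonneg _ (by positivity)
    nlinarith [sq_nonneg (((v 0 - x 0 : ℤ) : ℝ))]
  have h0 : (0 : ℝ) / ((T : ℝ) + 2) = 0 := zero_div _
  linarith

/-- On the sides `|X| = n + 1`, `0 ≤ Y ≤ T` of the wide rectangle (`n + 1 = 4(T+1)`):
`w ≤ (T+1)/(T+2) - (16/15)(1 - 1/16) < 0`. [folklore] -/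
theorem topBarrier_side_nonpos (hnT : (n : ℤ) + 1 = 4 * ((T : ℤ) + 1)) {v : Site 2}
    (hv0 : v 0 = x 0 - n - 1 ∨ v 0 = x 0 + n + 1) (hv1 : x 1 ≤ v 1 ∧ v 1 ≤ x 1 + T) :
    w v ≤ 0 := by
  rw [hw]
  have hnT' : (n : ℝ) + 1 = 4 * ((T : ℝ) + 1) := by exact_mod_cast hnT
  have hX : ((v 0 - x 0 : ℤ) : ℝ) ^ 2 = ((n : ℝ) + 1) ^ 2 := by
    rcases hv0 with h | h
    · have : (v 0 - x 0 : ℤ) = -((n : ℤ) + 1) := by omega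
      rw [this]; push_cast; ring
    · have : (v 0 - x 0 : ℤ) = (n : ℤ) + 1 := by omega
      rw [this]; push_cast; ring
  rw [hX]
  set Y : ℝ := ((v 1 - x 1 : ℤ) : ℝ) with hYdef
  have hY0 : 0 ≤ Y := by
    have : (0 : ℤ) ≤ v 1 - x 1 := by omega
    rw [hYdef]; exact_mod_cast this
  have hYT : Y ≤ T := by
    have : (v 1 - x 1 : ℤ) ≤ (T : ℤ) := by omega
    rw [hYdef]; exact_mod_cast this
  have hT2 : (0 : ℝ) < (T : ℝ) + 2 := by positivity
  have hn1 : (0 : ℝ) < ((n : ℝ) + 1) ^ 2 := by positivity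
  -- first term ≤ (T+1)/(T+2) < 1, second term ≥ (16/15)(15/16) = 1
  have h1 : (Y + 1) / ((T : ℝ) + 2) ≤ ((T : ℝ) + 1) / ((T : ℝ) + 2) :=
    div_le_div_of_nonneg_right (by linarith) hT2.le
  have h1' : ((T : ℝ) + 1) / ((T : ℝ) + 2) < 1 := by
    rw [div_lt_one hT2]; linarith
  set Z : ℝ := (((n : ℝ) + 1) ^ 2 - (Y + 1) ^ 2) / ((n : ℝ) + 1) ^ 2 with hZ
  have h2 : 15 / 16 ≤ Z := by
    rw [hZ, le_div_iff₀ hn1]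
    have : (Y + 1) ^ 2 ≤ ((T : ℝ) + 1) ^ 2 := by nlinarith
    nlinarith
  have e : (Y + 1) / ((T : ℝ) + 2) - 16 / 15 * (((n : ℝ) + 1) ^ 2 - (Y + 1) ^ 2) /
      ((n : ℝ) + 1) ^ 2 = (Y + 1) / ((T : ℝ) + 2) - 16 / 15 * Z := by
    rw [hZ]; ring
  rw [e]
  linarith

/-- On the top row `Y = T + 1` of the wide rectangle, `w ≤ 1 + (16/15)(T+2)²/(n+1)² ≤ 19/15`.
[folklore] -/
theorem topBarrier_top_le (hnT : (n : ℤ) + 1 = 4 * ((T : ℤ) + 1)) {v : Site 2}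
    (hv1 : v 1 = x 1 + T + 1) : w v ≤ 19 / 15 := by
  rw [hw]
  have hnT' : (n : ℝ) + 1 = 4 * ((T : ℝ) + 1) := by exact_mod_cast hnT
  have hY : ((v 1 - x 1 : ℤ) : ℝ) + 1 = (T : ℝ) + 2 := by
    have : (v 1 - x 1 : ℤ) = (T : ℤ) + 1 := by omega
    rw [this]; push_cast; ring
  rw [hY]
  have hT2 : (0 : ℝ) < (T : ℝ) + 2 := by positivity
  have hn1 : (0 : ℝ) < ((n : ℝ) + 1) ^ 2 := by positivity
  rw [div_self hT2.ne']
  have key : -(4 / 15) ≤ 16 / 15 * (((v 0 - x 0 : ℤ) : ℝ) ^ 2 - ((T : ℝ) + 2) ^ 2) /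
      ((n : ℝ) + 1) ^ 2 := by
    rw [le_div_iff₀ hn1]
    have hsq := sq_nonneg (((v 0 - x 0 : ℤ) : ℝ))
    have : ((T : ℝ) + 2) ^ 2 ≤ 1 / 4 * ((n : ℝ) + 1) ^ 2 := by
      rw [hnT']; nlinarith
    nlinarith
  linarith

/-- At the centre of the bottom row, `w(x) = 1/(T+2) + (16/15)/(n+1)² ≥ 1/(T+2)`. [folklore] -/
theorem topBarrier_self_ge : 1 / ((T : ℝ) + 2) ≤ w x := by
  rw [hw]
  simp only [sub_self, Int.cast_zero, zero_add]
  have : 0 ≤ -(16 / 15 * ((0 : ℝ) ^ 2 - (1 : ℝ) ^ 2) / ((n : ℝ) + 1) ^ 2) := by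
    rw [neg_nonneg]
    apply div_nonpos_of_nonpos_of_nonneg _ (by positivity)
    norm_num
  linarith

end TopBarrier

/-- **The harmonic measure of the top side of a wide rectangle from the centre of its bottom
row.** For the rectangle `R = {|v₀ - x₀| ≤ n, x₁ ≤ v₁ ≤ x₁ + T}` with `n + 1 = 4(T+1)`,
`∑_{z ∈ ∂R, z₁ = x₁ + T + 1} H_R(x, z) ≥ (15/19)/(T+2)`. [folklore] -/
theorem sum_poissonKernel_top_ge {R : Finset (Site 2)} {x : Site 2} {n T : ℕ}
    (hR : ∀ v : Site 2, v ∈ R ↔ (x 0 - n ≤ v 0 ∧ v 0 ≤ x 0 + n) ∧ (x 1 ≤ v 1 ∧ v 1 ≤ x 1 + T))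
    (hnT : (n : ℤ) + 1 = 4 * ((T : ℤ) + 1)) :
    15 / 19 / ((T : ℝ) + 2) ≤
      ∑ z ∈ (outerBoundary (zdGraph 2) R).filter (fun z => z 1 = x 1 + T + 1),
        poissonKernel R x z := by
  have hd : 0 < 2 := by norm_num
  set w : Site 2 → ℝ := fun v => (((v 1 - x 1 : ℤ) : ℝ) + 1) / ((T : ℝ) + 2) -
    16 / 15 * (((v 0 - x 0 : ℤ) : ℝ) ^ 2 - (((v 1 - x 1 : ℤ) : ℝ) + 1) ^ 2) / ((n : ℝ) + 1) ^ 2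
    with hwdef
  have hw : ∀ v : Site 2, w v = (((v 1 - x 1 : ℤ) : ℝ) + 1) / ((T : ℝ) + 2) -
      16 / 15 * (((v 0 - x 0 : ℤ) : ℝ) ^ 2 - (((v 1 - x 1 : ℤ) : ℝ) + 1) ^ 2) / ((n : ℝ) + 1) ^ 2 :=
    fun v => rfl
  have hx : x ∈ R := self_mem_halfRect hR
  have hrep := green_representation hd R w hx
  have hvol : ∑ v ∈ R, dirichletGreen R x v * (-latticeLaplacianZd w v) = 0 :=
    Finset.sum_eq_zero fun v _ => by rw [latticeLaplacianZd_topBarrier hw, neg_zero, mul_zero]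
  rw [hvol, zero_add] at hrep
  -- pointwise: `H w ≤ (19/15) H` on the top row, `≤ 0` elsewhere
  have hpt : ∀ z ∈ outerBoundary (zdGraph 2) R, poissonKernel R x z * w z ≤
      19 / 15 * (if z 1 = x 1 + T + 1 then poissonKernel R x z else 0) := by
    intro z hz
    have hH := poissonKernel_nonneg hd R x z
    rcases outerBoundary_halfRect hR hz with h | h | h
    · rw [if_neg (by omega)]
      have := topBarrier_bottom_nonpos hw h.1
      nlinarith
    · rw [if_pos h.1]
      have := topBarrier_top_le hw hnT h.1
      nlinarith
    · rw [if_neg (by omega)]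
      have := topBarrier_side_nonpos hw hnT h.1 h.2
      nlinarith
  have key : w x ≤ 19 / 15 * ∑ z ∈ (outerBoundary (zdGraph 2) R).filter
      (fun z => z 1 = x 1 + T + 1), poissonKernel R x z := by
    calc w x = ∑ z ∈ outerBoundary (zdGraph 2) R, poissonKernel R x z * w z := hrep
      _ ≤ ∑ z ∈ outerBoundary (zdGraph 2) R,
          19 / 15 * (if z 1 = x 1 + T + 1 then poissonKernel R x z else 0) := Finset.sum_le_sum hpt
      _ = 19 / 15 * ∑ z ∈ (outerBoundary (zdGraph 2) R).filter (fun z => z 1 = x 1 + T + 1),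
          poissonKernel R x z := by rw [← Finset.mul_sum, Finset.sum_filter]
  have hx1 := topBarrier_self_ge hw (x := x)
  have hT2 : (0 : ℝ) < (T : ℝ) + 2 := by positivity
  rw [div_le_iff₀ hT2]
  rw [div_le_iff₀ hT2] at hx1
  have h3 := mul_le_mul_of_nonneg_right key hT2.le
  linarith

/-! ### Registered sub-goal of the stub carried by this file -/

/-- **Sub-goal `s10_topSideHarmonicMeasure`** (registered on stmt-CriticalPhenomena-14132; step
(C) of the Green-locality half G1 of `stub_clusterLocalityV2`): from the centre of the bottom row
of the lattice rectangle `{|v₀ - x₀| ≤ n, x₁ ≤ v₁ ≤ x₁ + T}` with `n + 1 = 4(T+1)`, the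
harmonic measure of the top row of its outer boundary is at least `(15/19)/(T+2)`
(`sum_poissonKernel_top_ge`). [folklore] -/
theorem s10_topSideHarmonicMeasure : ∀ (x : Literature.Probability.LatticeModels.Site 2) (n T : ℕ), (n : ℤ) + 1 = 4 * ((T : ℤ) + 1) → 15 / 19 / ((T : ℝ) + 2) ≤ ∑ z ∈ (Literature.Probability.LatticeModels.outerBoundary (Literature.Probability.LatticeModels.zdGraph 2) (Fintype.piFinset fun i => Finset.Icc ((![x 0 - n, x 1] : Literature.Probability.LatticeModels.Site 2) i) ((![x 0 + n, x 1 + T] : Literature.Probability.LatticeModels.Site 2) i))).filter (fun z => z 1 = x 1 + T + 1), Literature.Probability.LatticeModels.poissonKernel (Fintype.piFinset fun i => Finset.Icc ((![x 0 - n, x 1] : Literature.Probability.LatticeModels.Site 2) i) ((![x 0 + n, x 1 + T] : Literature.Probability.LatticeModels.Site 2) i)) x z :=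
  fun x n T hnT => sum_poissonKernel_top_ge (mem_piFinset_halfRect x n T) hnT

end Summit.CriticalPhenomena.CardyFormulaZ2.Cruxes.BoundaryDefectGaussianR.RainbowMonomialsInExcursionKernels

end
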